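import Summits.RiemannHypothesis.RiemannHypothesis.Theses.LiHeightLog
import Summits.RiemannHypothesis.RiemannHypothesis.Theorems.LiHeightLogLiCoshTailCountBound
import HarnessLib

/-!
# RiemannHypothesis / LiHeightLog — closer of crux `LiCoshTailCount` (deciding; RH-FREE zero counting)

Route `RiemannHypothesis/LiHeightLog` (cell `pub/rh-li`, round 6), item `LiCoshTailCount`
(stmt-RiemannHypothesis-19647): the route decl BY NAME, from `sum_liCoshWeight_le_liCoshTail`
(`Theorems/LiHeightLogLiCoshTailCountBound.lean`).  RH-FREE PROOF-OF-DATA rung L-P(P1-log) of the RH ladder's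
column LI; nothing here bears on the truth of RH.
-/

noncomputable section

-- D-0017: `Summit.<S>.<S>.…` is the designed namespace of a single-problem summit.
set_option linter.dupNamespace false

namespace Summit.RiemannHypothesis.RiemannHypothesis.Theorems

/-- **Crux `LiCoshTailCount` of route `LiHeightLog` holds** (RH-FREE): for `1000 ≤ T ≤ U` and every `n`,
`∑_{T < Im ρ ≤ U} m(ρ) liCoshWeight n (Im ρ) ≤ liCoshTail n T`. -/
theorem liCoshTailCount_proof : Summit.RiemannHypothesis.RiemannHypothesis.Theses.LiHeightLog.LiCoshTailCount := by
  unfold Summit.RiemannHypothesis.RiemannHypothesis.Theses.LiHeightLog.LiCoshTailCount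
  exact LiTheory.sum_liCoshWeight_le_liCoshTail

end Summit.RiemannHypothesis.RiemannHypothesis.Theorems

end
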